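import Summits.QuantumFields.YangMills.Theorems.BalabanUVNodesK0RecordFormatNamesFluctQtC

/-!
# Bałaban UV nodes, port S1 — LIST (c1): the COMPLEX fine perturbation `𝐔′ = exp(iξA)·𝐔` of configuration PAIRS ([I] (3.10)–(3.13) p.272), its real slice, the bridge of
# its variable `A` to the (4.4)∕(3.14) chart coordinates, and the volume re-indexing of ✓`recordK₀` (def-Y g41, ◇ lens-1 v26 §2 (c1); one additive file; definitions,
# `rfl`∕bridge faces and two `omega` lemmas; nothing asserted)

WHY.  [I] p.272: «Let us consider more generally the function E^{(j)}(X, exp iξA U_{k+1}).  It is obtained from the analytic function E^{(j)}(X, U′, J′) by the substitution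
U′ = exp iξA U_{k+1}, J′ = D^{ξ*}_{exp iξA U_{k+1}} ξ⁻² π Im ∂ exp iξA U_{k+1}.  (3.10) … (3.11) … we replace J_{k+1} by the variable J, and in the remaining expressions we
replace U_{k+1} by the new variable U.  Thus we obtain the following function of the variables U, J … (3.13)»; [II] p.2 L12–18 («there exists a function E(X, U, J, A)
analytic and localized … a given term is obtained substituting a proper nonlocal expression in the place of A»).  ◇'s LIST (c1) asks def-Y for the SUBSTITUTION MAP on the
record's complex configuration pairs ✓`Sect2.CPair (F.P K) (MatA 2)` with the variable `A ∈ 𝔄 = (FineIdx F K → ℂ)` — the space F_H's `H_k` lands in (✓`FHInterface.hkFunctional`,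
`FWPackage.H : … →L[ℂ] (FineIdx F K → ℂ)`), so that the generators `gen n j X φ A := (IH piece)_j X (pairPertC … φ A)` are DEFINED, not posited — plus the one-line volume
re-indexing `recordK₀ F Mc j + n_j = recordK₀ F Mc k + n`.  The FLUCTUATION-side complex chart ✓`pertC F k K Vk z` (`…K0RecordFormatNamesFluctQtC` §24o, level `k`, `V′V^{(k)}`)
already bears the name `pertC`; this file's objects are the FINE-side (level `0`) ones and are named `fineMatC ∕ finePertC ∕ pairPertC` to end the homonym before it starts.

WHAT THIS FILE IS (NEW names; every earlier object untouched):
* §24τ `fineMatC F K A b := Σ_a A(b,a) • su2Gen a` (✓`fineMat` with complex coefficients — 𝔰𝔩₂(ℂ) = 𝔤ᶜ-valued; real slice `rfl`), `fineMat_mem_lieSU`, `exp_fineMat_mem` (the real chart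
  is `SU(2)`-valued — twins of ✓`fluctMat_mem_lieSU` ∕ ✓`exp_fluctMat_mem` one level down).
* §24τ ★ `finePertC F K 𝐔 A := (b ↦ exp (fineMatC A b) · 𝐔 b)` — (3.10)'s `𝐔′ = exp(iξA)·𝐔` (print's `iξ` absorbed in the coordinates, exactly as in ✓`finePert`); BRIDGE
  `finePertC (coeField U) ↑y = coeField (finePert F K U y)`; `finePertC 𝐔 0 = 𝐔`.
* §24τ ★ `pairPertC F K jsh φ A := (finePertC φ.1 A, φ.2 + jsh φ.1 A)` — the PAIR substitution of (3.13) with the `J`-SHIFT `jsh` A PARAMETER, for this reason: print's (3.11)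
  `J(exp iξA·U) = J(U) + D^{ξ*}_U D^ξ_U A + F(U, A)` is then REWRITTEN ((3.11)–(3.13): «we replace the operator D*D by D*D + DRD* = … = Δ − P + (lower order, local operator)»,
  legitimate on the Landau-gauge `A = H_j` only) by the expansion (1.43)–(1.54) of [14] — NOT ported; the (3.10)-LITERAL candidate `J ↦ J + (J(exp iξA·𝐔) − J(𝐔))` through the
  tree's (1.8) current ✓`B12Eq18Current.current` needs a units-valued reading of `𝐔` (true on `U^c`, `Gᶜ`-valued).  The assembly supplies `jsh`; at `jsh 𝐔 0 = 0` the pair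
  substitution fixes `φ` at `A = 0` (`pairPertC_zero`).
* §24υ `chartOfFine F K A` — the change of coordinates `(su2Gen, FineIdx) → (sl2Gen, Fin (recordChartDim F K))` with ★ `chartMat F K (chartOfFine F K A) b = fineMatC F K A b`, so that
  (3.14)'s analyticity domain «|A|, |∇^ξ_U A|, |Δ^ξ_U A| < α₂ on X» is ✓`recordDom44` BY NAME: `fineDom314 F Mc k K X α₂ := chartOfFine F K ⁻¹' recordDom44 F Mc k K X α₂`.
* §24φ `recordK₀_mono`, ★ `recordK₀_add_reidx : recordK₀ F Mc j + (n + (k − j)) = recordK₀ F Mc k + n` (`j ≤ k`) — the volume RE-INDEXING of ◇'s (c1): the level-`j` IH pieces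
  live on the SAME member volumes.

HONEST SCOPE.  Substitution FORMAT only: total functions, `rfl`∕bridge faces, two arithmetic lemmas; the `J`-shift is a parameter (said why); no analyticity row is proved here
(«entire in (φ, A)» for `finePertC` is `exp ∘ linear` × constant — a prover's line when a consumer cites it); nothing asserted or inhabited; no RG estimate.  ⟨stmt-QuantumFields-27930⟩
2∕7 · K0ᴬ 0∕2 · NODE O 0∕1 · COUNT 8∕28 · K 1∕4 UNMOVED; finite `𝕋⁴_{L^K}` at fixed ε — NOT continuum ∕ OS ∕ Clay; **the Yang–Mills mass gap is NOT proved by any of this.**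
No `sorry`, `instance`, `notation`.
-/

noncomputable section

open scoped BigOperators Matrix.Norms.L2Operator

namespace Summit.QuantumFields.YangMills.Theorems.K0RecordFormatNames

open Literature.MathematicalPhysics.QuantumFieldTheory.Balaban1983to89
open Literature.MathematicalPhysics.QuantumFieldTheory.Balaban1983to89.Node00
open Literature.MathematicalPhysics.QuantumFieldTheory.Balaban1983to89.T4Continuum (T4Family)
open Summit.QuantumFields.YangMills.Theorems.BalabanUVNodesPortS1 (star_su2Gen trace_su2Gen)
open NormedSpace (exp)
open _root_.Matrix

variable (F : T4Family)

/-! ## §24τ  (c1) The complex fine chart `exp(iξA)·𝐔` and the pair substitution of (3.10)–(3.13) -/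

/-- **Complex fine coordinates → matrices**: `fineMatC F K A b := Σ_a A(b,a) • su2Gen a` (✓`fineMat` with `A : FineIdx → ℂ`; for real `A` it is 𝔰𝔲(2)-valued, in general 𝔰𝔩(2,ℂ)-valued —
print's `𝔤ᶜ`; the twin of ✓`fluctMatC` one level down). [cite: Balaban1987RG1, (3.10) p.272, (1.10) p.262] -/
def fineMatC (K : ℕ) (A : FineIdx F K → ℂ) (b : PBond (F.P K) 0) : MatA 2 := ∑ a, A (b, a) • su2Gen a

/-- On real coordinates `fineMatC` IS ✓`fineMat` (`rfl`). [cite: Balaban1987RG1, (3.10) p.272 (bookkeeping)] -/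
theorem fineMatC_ofReal (K : ℕ) (y : FineIdx F K → ℝ) (b : PBond (F.P K) 0) : fineMatC F K (fun i => (y i : ℂ)) b = fineMat F K y b := rfl

/-- `fineMatC 0 = 0`. [cite: Balaban1987RG1, (3.10) p.272 (bookkeeping)] -/
theorem fineMatC_zero (K : ℕ) (b : PBond (F.P K) 0) : fineMatC F K 0 b = 0 := by
  simp [fineMatC]

/-- `fineMatC` is additive in `A`. [folklore] -/
theorem fineMatC_add (K : ℕ) (A A' : FineIdx F K → ℂ) (b : PBond (F.P K) 0) : fineMatC F K (A + A') b = fineMatC F K A b + fineMatC F K A' b := by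
  simp [fineMatC, add_smul, Finset.sum_add_distrib]

/-- `fineMatC` is ℂ-homogeneous in `A`. [folklore] -/
theorem fineMatC_smul (K : ℕ) (c : ℂ) (A : FineIdx F K → ℂ) (b : PBond (F.P K) 0) : fineMatC F K (c • A) b = c • fineMatC F K A b := by
  simp [fineMatC, Finset.smul_sum, smul_smul]

/-- `fineMat y b` lies in 𝔰𝔲(2) (twin of ✓`fluctMat_mem_lieSU`). [cite: Balaban1985Variational, (103) p.293 (bookkeeping)] -/
theorem fineMat_mem_lieSU (K : ℕ) (y : FineIdx F K → ℝ) (b : PBond (F.P K) 0) : fineMat F K y b ∈ T4AdjointCovarianceUnitary.lieSU (Fin 2) := by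
  rw [T4AdjointCovarianceUnitary.mem_lieSU_iff, fineMat]
  constructor
  · rw [star_sum, ← Finset.sum_neg_distrib]
    refine Finset.sum_congr rfl fun a _ => ?_
    rw [star_smul, star_su2Gen, Complex.star_def, Complex.conj_ofReal, smul_neg]
  · rw [Matrix.trace_sum]
    exact Finset.sum_eq_zero fun a _ => by rw [Matrix.trace_smul, trace_su2Gen, smul_zero]

/-- `exp(fineMat y b) ∈ SU(2)` (twin of ✓`exp_fluctMat_mem`): the real fine chart is `SU(2)`-valued. [cite: Balaban1985Variational, (103) p.293 («exp(A)·U»)] -/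
theorem exp_fineMat_mem (K : ℕ) (y : FineIdx F K → ℝ) (b : PBond (F.P K) 0) : exp (fineMat F K y b) ∈ Matrix.specialUnitaryGroup (Fin 2) ℂ :=
  T4AdjointCovarianceUnitary.exp_mem_specialUnitaryGroup_of_mem_lieSU (fineMat_mem_lieSU F K y b)

/-- ★ **(3.10) `𝐔′ = exp(iξA)·𝐔` AS A COMPLEX MATRIX FIELD — `finePertC F K 𝐔 A := (b ↦ exp (fineMatC A b) · 𝐔 b)`** on `M₂(ℂ)`-valued fine-bond functions `𝐔` (the `𝐔`-component of a pair of
✓`Sect2.CPair (F.P K) (MatA 2)`), complex `A`; print's factor `iξ` is absorbed in the coordinates exactly as in the real chart ✓`finePert` (`finePertC_ofReal`).  Entire in `(𝐔, A)` (`exp ∘` linear,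
times `𝐔`) — a prover's line, not stated here. [cite: Balaban1987RG1, (3.10) p.272, (2.6)–(2.8) p.267] -/
def finePertC (K : ℕ) (U : PBond (F.P K) 0 → MatA 2) (A : FineIdx F K → ℂ) : PBond (F.P K) 0 → MatA 2 :=
  fun b => exp (fineMatC F K A b) * U b

/-- Unfolding (`rfl`). [cite: Balaban1987RG1, (3.10) p.272 (bookkeeping)] -/
theorem finePertC_apply (K : ℕ) (U : PBond (F.P K) 0 → MatA 2) (A : FineIdx F K → ℂ) (b : PBond (F.P K) 0) :
    finePertC F K U A b = exp (fineMatC F K A b) * U b := rfl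

/-- ★ BRIDGE TO THE REAL CHART: on real coordinates at an `SU(2)` configuration the complex chart is the coercion of ✓`finePert`: `finePertC ↑U ↑y = ↑(finePert U y)`.
[cite: Balaban1987RG1, (3.10) p.272, (2.6) p.267 (bookkeeping)] -/
theorem finePertC_ofReal (K : ℕ) (U : GaugeField (F.P K) 0 (SU 2)) (y : FineIdx F K → ℝ) :
    finePertC F K (coeField U) (fun i => (y i : ℂ)) = coeField (finePert F K U y) := by
  funext b
  rw [finePertC, fineMatC_ofReal, coeField_apply, coeField_apply, finePert, suOfMat_of_mem (exp_fineMat_mem F K y b)]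
  rfl

/-- At `A = 0` the complex chart sits at `𝐔`: `finePertC 𝐔 0 = 𝐔`. [cite: Balaban1987RG1, (3.10) p.272 (bookkeeping)] -/
theorem finePertC_zero (K : ℕ) (U : PBond (F.P K) 0 → MatA 2) : finePertC F K U 0 = U := by
  funext b
  rw [finePertC, fineMatC_zero, NormedSpace.exp_zero, one_mul]

/-- ★ **THE PAIR SUBSTITUTION OF (3.13) — `pairPertC F K jsh φ A := (exp(iξA)·𝐔, 𝐉 + jsh 𝐔 A)`** on the record's complex configuration pairs `φ = (𝐔, 𝐉)`, with the `J`-SHIFT `jsh` A PARAMETER: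
print (3.11) `J(exp iξA·U) = J(U) + D^{ξ*}_U D^ξ_U A + F(U, A)` («F a local operator depending on U, ∂U, A, ∇^ξ_U A only»), then (3.12)–(3.13) «we replace J_{k+1} by the variable J» AND rewrite
`D*D` as `Δ − P + (lower order)` (valid on the Landau gauge `R D* A = 0`) through [14] (1.43)–(1.54) — an expansion NOT ported; the (3.10)-literal shift `J(exp iξA·𝐔) − J(𝐔)` through ✓`B12Eq18Current.current`
needs `𝐔` units-valued (true on `U^c`).  The assembly chooses `jsh`; this def fixes the FORMAT the generators `gen … φ A := (IH piece) X (pairPertC … φ A)` are written in.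
[cite: Balaban1987RG1, (3.10)–(3.13) p.272; Balaban1988RG2Cluster, p.2 L12–18] -/
def pairPertC (K : ℕ) (jsh : (PBond (F.P K) 0 → MatA 2) → (FineIdx F K → ℂ) → PBond (F.P K) 0 → MatA 2) (φ : Sect2.CPair (F.P K) (MatA 2)) (A : FineIdx F K → ℂ) :
    Sect2.CPair (F.P K) (MatA 2) :=
  (finePertC F K φ.1 A, fun b => φ.2 b + jsh φ.1 A b)

/-- The `𝐔`-component of the substituted pair is the complex chart (`rfl`). [cite: Balaban1987RG1, (3.10) p.272 (bookkeeping)] -/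
theorem pairPertC_fst (K : ℕ) (jsh : (PBond (F.P K) 0 → MatA 2) → (FineIdx F K → ℂ) → PBond (F.P K) 0 → MatA 2) (φ : Sect2.CPair (F.P K) (MatA 2)) (A : FineIdx F K → ℂ) :
    (pairPertC F K jsh φ A).1 = finePertC F K φ.1 A := rfl

/-- The `𝐉`-component of the substituted pair is `𝐉 + jsh 𝐔 A` (`rfl`). [cite: Balaban1987RG1, (3.13) p.272 (bookkeeping)] -/
theorem pairPertC_snd (K : ℕ) (jsh : (PBond (F.P K) 0 → MatA 2) → (FineIdx F K → ℂ) → PBond (F.P K) 0 → MatA 2) (φ : Sect2.CPair (F.P K) (MatA 2)) (A : FineIdx F K → ℂ) :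
    (pairPertC F K jsh φ A).2 = fun b => φ.2 b + jsh φ.1 A b := rfl

/-- At `A = 0` the pair substitution fixes `φ`, provided the `J`-shift vanishes at `A = 0` (as both of print's candidates do). [cite: Balaban1987RG1, (3.10)–(3.13) p.272 (bookkeeping)] -/
theorem pairPertC_zero (K : ℕ) {jsh : (PBond (F.P K) 0 → MatA 2) → (FineIdx F K → ℂ) → PBond (F.P K) 0 → MatA 2} (φ : Sect2.CPair (F.P K) (MatA 2)) (h : jsh φ.1 0 = 0) :
    pairPertC F K jsh φ 0 = φ := by
  refine Prod.ext (finePertC_zero F K φ.1) ?_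
  funext b
  show φ.2 b + jsh φ.1 0 b = φ.2 b
  rw [h, Pi.zero_apply, add_zero]

/-! ## §24υ  (c1) The variable `A` in the (4.4)∕(3.14) chart coordinates: `su2Gen ↔ sl2Gen` -/

/-- **The change of coordinates `(su2Gen, FineIdx) → (sl2Gen, Fin (recordChartDim F K))`**: `su2Gen 0 = i(E₁₂ + E₂₁)`, `su2Gen 1 = E₁₂ − E₂₁`, `su2Gen 2 = i(E₁₁ − E₂₂)`, so the 𝔰𝔩₂-coordinates of
`fineMatC A b` are `(iA₀ + A₁, iA₀ − A₁, iA₂)` at `(b, ·)`; read through ✓`chartEquiv`. [cite: Balaban1987RG1, (1.10) p.262, p.258 (local coordinates; bookkeeping)] -/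
def chartOfFine (K : ℕ) (A : FineIdx F K → ℂ) : Fin (recordChartDim F K) → ℂ :=
  fun i => ![Complex.I * A (((chartEquiv F K).symm i).1, 0) + A (((chartEquiv F K).symm i).1, 1),
    Complex.I * A (((chartEquiv F K).symm i).1, 0) - A (((chartEquiv F K).symm i).1, 1),
    Complex.I * A (((chartEquiv F K).symm i).1, 2)] ((chartEquiv F K).symm i).2

/-- ★ **The two charts agree**: `chartMat F K (chartOfFine F K A) b = fineMatC F K A b` — the variable `A` of `finePertC` IS the `w` of ✓`recordChart` ∕ ✓`recordDom44` after the change of basis.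
[cite: Balaban1987RG1, (1.10) p.262, (4.4) p.281 (bookkeeping)] -/
theorem chartMat_chartOfFine (K : ℕ) (A : FineIdx F K → ℂ) (b : PBond (F.P K) 0) : chartMat F K (chartOfFine F K A) b = fineMatC F K A b := by
  simp only [chartMat, chartOfFine, Equiv.symm_apply_apply, fineMatC, Fin.sum_univ_three]
  ext i j
  fin_cases i <;> fin_cases j <;> simp [sl2Gen, su2Gen, Matrix.add_apply] <;> ring

/-- **(3.14)'s ANALYTICITY DOMAIN OF THE VARIABLE `A`, BY NAME**: «|A|, |∇^ξ_U A|, |Δ^ξ_U A| < α₂ on X» = ✓`recordDom44 F Mc k K X α₂` (print's (4.4), the same three seminorms) pulled back along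
`chartOfFine`. [cite: Balaban1987RG1, (3.14) p.272, (4.4) p.281] -/
def fineDom314 (Mc k K : ℕ) (X : (recordDomSys F Mc k K).Dom) (α₂ : ℝ) : Set (FineIdx F K → ℂ) :=
  chartOfFine F K ⁻¹' recordDom44 F Mc k K X α₂

/-! ## §24φ  (c1) Volume re-indexing of the member volumes `recordK₀ F Mc k + n` across levels `j ≤ k` -/

/-- `recordK₀` is monotone in the level. [cite: Balaban1987RG1, p.257 (bookkeeping)] -/
theorem recordK₀_mono (Mc : ℕ) {j k : ℕ} (h : j ≤ k) : recordK₀ F Mc j ≤ recordK₀ F Mc k := by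
  unfold recordK₀; omega

/-- ★ **VOLUME RE-INDEXING**: the member volume `recordK₀ F Mc k + n` of the level-`k` texts IS the member volume `recordK₀ F Mc j + n_j` of the level-`j` texts with `n_j := n + (k − j)`
(`j ≤ k`) — so the level-`j` IH pieces `(Ψ_j, Ew_j)` of `FEResidueRegBoxAt … j` are available on the very volumes the level-`k` step works on. [cite: Balaban1987RG1, p.257, (1.21) p.264 (bookkeeping)] -/
theorem recordK₀_add_reidx (Mc : ℕ) {j k : ℕ} (h : j ≤ k) (n : ℕ) : recordK₀ F Mc j + (n + (k - j)) = recordK₀ F Mc k + n := by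
  unfold recordK₀; omega

end Summit.QuantumFields.YangMills.Theorems.K0RecordFormatNames

end
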